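import Literature.Combinatorics.SimpleGraph.TreeDecompositionChunks
import Literature.Computability.MetaComplexity.ScopeExpansion
import Mathlib.Algebra.Order.Floor.Defs
import Mathlib.Algebra.Order.Floor.Semiring
import HarnessLib

/-!
# Boundary expanders have linear treewidth

Topic `Literature/Computability/MetaComplexity`, companion of `ScopeExpansion.lean` (boundary /
unique-neighbour expansion of a family of scopes `S : ι → Finset ℕ`, Ben-Sasson–Wigderson) and
client of `Literature.Combinatorics.SimpleGraph.TreeDecompositionChunks` (a graph of treewidth
`≤ k` splits off `r/2 ≤ |F| ≤ r` vertices behind `≤ k + 1` vertices). The calibration fact behind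
"column weight two is the graph case": if the scopes have `≤ ℓ` points each, every point lies in at
least two scopes (the family is BOUNDARYLESS, e.g. the rows of an unsolvable core of a linear system
over `𝔽₂`), and every `≤ r` scopes have `≥ c` unique-neighbour points per scope, then any graph on
the indices in which intersecting scopes are adjacent (the ROW GRAPH, or primal graph of the dual
hypergraph) has treewidth `≥ c(r-1)/(2ℓ) - 1`. Indeed a chunk `F` of `r/2 ≤ |F| ≤ r` indices whose
outside neighbours lie in a set `B` of `≤ tw + 1` indices has all its `≥ c|F|` unique-neighbour
points covered by the scopes of `B` (a unique neighbour of `F` lies in a second scope, necessarily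
outside `F` and adjacent to the first), so `c · r/2 ≲ c|F| ≤ ℓ(tw + 1)`. For graph Tseitin formulas
(`ℓ =` degree, column weight `2`) this is the familiar `tw(G) = Ω(edge expansion)`; combined with
the Galesi–Itsykson–Riazanov–Sofronova bound `2^{tw^{Ω(1/d)}}` for depth-`d` Frege refutations of
Tseitin formulas it gives the expansion-scale law at column weight `2`.

* `IsBoundaryExpander.comp_of_injective`, `boundary_comp_eq` — reindexing a scope family along an
  injection preserves boundaries and boundary expansion;
* `lt_card_of_boundary_univ_eq_empty` — a nonempty boundaryless `(r, c)`-expander, `c > 0`, has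
  more than `r` scopes; `le_of_isBoundaryExpander_singleton` — `c ≤ ℓ` once `r ≥ 1`;
* `boundary_subset_biUnion_of_adj_closed` — in a boundaryless family, the unique neighbours of a
  set `F` of indices closed under adjacency up to `B` are points of scopes of `B`;
* **`mul_le_mul_treewidth_of_isBoundaryExpander`** — `c (r - 1) / 2 ≤ ℓ (tw + 1)`.

## References

* E. Ben-Sasson, A. Wigderson, *Short proofs are narrow — resolution made simple*, J. ACM 48
  (2001), §5–6 (boundary expansion) [BenSassonWigderson2001].
* N. Galesi, D. Itsykson, A. Riazanov, A. Sofronova, *Bounded-depth Frege complexity of Tseitin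
  formulas for all graphs*, Ann. Pure Appl. Logic 174 (2023) 103166, §1 (treewidth governs
  bounded-depth Frege size of Tseitin formulas; expanders have linear treewidth) [GalesiEtAl2023].
* N. Robertson, P. D. Seymour, *Graph minors. II*, J. Algorithms 7 (1986), (2.5)–(2.6)
  [RobertsonSeymour1986].
-/

namespace Literature.Computability.MetaComplexity

open Finset Literature.Combinatorics.SimpleGraph

section Reindex

variable {ι κ : Type*} [DecidableEq ι] [DecidableEq κ] (S : ι → Finset ℕ)

/-- **Boundaries are preserved by injective reindexing**: the boundary of `F'` in the family
`S ∘ f` is the boundary of `f(F')` in `S`. [folklore] -/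
theorem boundary_comp_eq (f : κ ↪ ι) (F' : Finset κ) :
    boundary (S ∘ f) F' = boundary S (F'.map f) := by
  ext x
  have hcov : x ∈ cover (S ∘ f) F' ↔ x ∈ cover S (F'.map f) := by
    simp only [mem_cover, Function.comp_apply, Finset.mem_map]
    constructor
    · rintro ⟨a, ha, hx⟩; exact ⟨f a, ⟨a, ha, rfl⟩, hx⟩
    · rintro ⟨i, ⟨a, ha, rfl⟩, hx⟩; exact ⟨a, ha, hx⟩
  have hdeg : coverDegree (S ∘ f) F' x = coverDegree S (F'.map f) x := by
    unfold coverDegree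
    rw [Finset.filter_map, Finset.card_map]
    rfl
  rw [mem_boundary, mem_boundary, hcov, hdeg]

variable {S} in
/-- **Boundary expansion is preserved by injective reindexing** (sub-families of an expander
expand). [folklore] -/
theorem IsBoundaryExpander.comp_of_injective {r c : ℝ} (h : IsBoundaryExpander S r c) (f : κ ↪ ι) :
    IsBoundaryExpander (S ∘ f) r c := by
  intro F' hF'
  rw [boundary_comp_eq S f F', ← Finset.card_map f]
  exact h (F'.map f) (by rwa [Finset.card_map])

end Reindex

section Treewidth

variable {ι : Type*} (S : ι → Finset ℕ)

/-- The cover of a single index is its scope. [folklore] -/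
theorem cover_singleton (i : ι) : cover S {i} = S i := by
  simp [cover]

variable {S} [DecidableEq ι]

/-- **`c ≤ ℓ`**: in an `(r, c)`-boundary expander with `r ≥ 1` whose scopes have `≤ ℓ` points,
`c ≤ ℓ` (expansion of a single scope). [folklore] -/
theorem le_of_isBoundaryExpander_singleton {ℓ : ℕ} (hℓ : ∀ i, (S i).card ≤ ℓ) {r c : ℝ}
    (hr : 1 ≤ r) (hexp : IsBoundaryExpander S r c) (i : ι) : c ≤ ℓ := by
  have h := hexp {i} (by simpa using hr)
  rw [Finset.card_singleton, Nat.cast_one, mul_one] at h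
  refine h.trans ?_
  have h2 : (boundary S {i}).card ≤ ℓ :=
    ((Finset.card_le_card (boundary_subset_cover (S := S) {i})).trans
      (by rw [cover_singleton])).trans (hℓ i)
  exact_mod_cast h2

/-- **A nonempty boundaryless expander has more than `r` scopes.** [cite: BenSassonWigderson2001, §5] -/
theorem lt_card_of_boundary_univ_eq_empty [Fintype ι] [Nonempty ι] {r c : ℝ} (hc : 0 < c)
    (hexp : IsBoundaryExpander S r c) (hcl : boundary S Finset.univ = ∅) :
    r < Fintype.card ι := by
  by_contra hle
  push Not at hle
  have h := hexp Finset.univ (by rwa [Finset.card_univ])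
  rw [hcl, Finset.card_empty, Nat.cast_zero, Finset.card_univ] at h
  have hpos : (0 : ℝ) < Fintype.card ι := by exact_mod_cast Fintype.card_pos
  nlinarith

/-- **Unique neighbours of a closed chunk are covered by the separator.** In a boundaryless
family (every point of a scope lies in a second scope), if `G` makes intersecting scopes adjacent
and every `G`-neighbour of an index of `F` lies in `F` or in `B`, then every boundary point of `F`
is a point of a scope of `B`. [folklore] -/
theorem boundary_subset_biUnion_of_adj_closed [Fintype ι] (hcl : boundary S Finset.univ = ∅)
    (G : _root_.SimpleGraph ι) (hG : ∀ i j, i ≠ j → (S i ∩ S j).Nonempty → G.Adj i j)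
    {F B : Finset ι} (hFB : ∀ u ∈ F, ∀ v, G.Adj u v → v ∈ F ∨ v ∈ B) :
    boundary S F ⊆ B.biUnion S := by
  intro x hx
  obtain ⟨hxcov, hdeg⟩ := mem_boundary.1 hx
  obtain ⟨u, huF, hxu⟩ := mem_cover.1 hxcov
  -- a second scope through `x`
  have hdeg_univ : coverDegree S Finset.univ x ≠ 1 := by
    intro h1
    have : x ∈ boundary S Finset.univ :=
      mem_boundary.2 ⟨mem_cover.2 ⟨u, Finset.mem_univ u, hxu⟩, h1⟩
    rw [hcl] at this
    exact Finset.notMem_empty x this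
  have hu_in : u ∈ Finset.univ.filter (fun i => x ∈ S i) := by simp [hxu]
  have htwo : 1 < (Finset.univ.filter fun i => x ∈ S i).card := by
    have h1 : 1 ≤ (Finset.univ.filter fun i => x ∈ S i).card := Finset.card_pos.2 ⟨u, hu_in⟩
    have hne : (Finset.univ.filter fun i => x ∈ S i).card ≠ 1 := hdeg_univ
    omega
  obtain ⟨v, hv_in, hvu⟩ := Finset.exists_mem_ne htwo u
  have hxv : x ∈ S v := by simpa using hv_in
  -- `v ∉ F`: `x` is a unique neighbour of `F`
  have hvF : v ∉ F := by
    intro hvF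
    have hsub : ({u, v} : Finset ι) ⊆ F.filter fun i => x ∈ S i := by
      intro i hi
      rcases Finset.mem_insert.1 hi with rfl | hi
      · simp [huF, hxu]
      · rw [Finset.mem_singleton.1 hi]; simp [hvF, hxv]
    have h2 : 2 ≤ coverDegree S F x := by
      unfold coverDegree
      simpa [Finset.card_pair hvu.symm] using Finset.card_le_card hsub
    omega
  -- so `v` is a neighbour of `u` outside `F`, hence in `B`
  have hadj : G.Adj u v := hG u v hvu.symm ⟨x, Finset.mem_inter.2 ⟨hxu, hxv⟩⟩
  rcases hFB u huF v hadj with hvF' | hvB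
  · exact absurd hvF' hvF
  · exact Finset.mem_biUnion.2 ⟨v, hvB, hxv⟩

/-- **Boundary expanders have linear treewidth.** Let `S : ι → Finset ℕ` be a nonempty finite
family of scopes with `≤ ℓ` points each which is an `(r, c)`-boundary expander (`c > 0`) and
boundaryless (`boundary S univ = ∅`: every point lies in at least two scopes), and let `G` be a
graph on `ι` in which indices with intersecting scopes are adjacent. Then
`c (r - 1) / 2 ≤ ℓ (tw(G) + 1)`. (With `c = 3ℓ/4`: `tw(G) ≥ 3(r-1)/8 - 1`.)
[cite: GalesiEtAl2023, §1] -/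
theorem mul_le_mul_treewidth_of_isBoundaryExpander [Fintype ι] [Nonempty ι] {ℓ : ℕ} (hℓ : ∀ i, (S i).card ≤ ℓ)
    {r c : ℝ} (hc : 0 < c) (hexp : IsBoundaryExpander S r c) (hcl : boundary S Finset.univ = ∅)
    (G : _root_.SimpleGraph ι) (hG : ∀ i j, i ≠ j → (S i ∩ S j).Nonempty → G.Adj i j) :
    c * (r - 1) / 2 ≤ ℓ * (treewidth G + 1 : ℕ) := by
  classical
  have hℓ0 : (0 : ℝ) ≤ ℓ := Nat.cast_nonneg ℓ
  by_cases hr1 : r < 1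
  · have h1 : c * (r - 1) / 2 < 0 := by nlinarith
    have h2 : (0 : ℝ) ≤ ℓ * (treewidth G + 1 : ℕ) := by positivity
    linarith
  push Not at hr1
  have hr0 : 0 ≤ r := by linarith
  obtain ⟨i₀⟩ := ‹Nonempty ι›
  have hcℓ : c ≤ ℓ := le_of_isBoundaryExpander_singleton hℓ hr1 hexp i₀
  have hcard : r < Fintype.card ι := lt_card_of_boundary_univ_eq_empty hc hexp hcl
  set k := treewidth G with hk
  set r₀ := ⌊r⌋₊ with hr₀
  have hr₀card : r₀ < Fintype.card ι := (Nat.floor_lt hr0).2 hcard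
  have hr₀le : (r₀ : ℝ) ≤ r := Nat.floor_le hr0
  have hltr₀ : r < r₀ + 1 := Nat.lt_floor_add_one r
  by_cases hkr : 2 * (k + 1) ≤ r₀
  · obtain ⟨F, B, hB, -, hlo, hhi, hFB⟩ := exists_chunk_of_treewidth_le G le_rfl hkr hr₀card
    have hFr : (F.card : ℝ) ≤ r := le_trans (by exact_mod_cast hhi) hr₀le
    have h1 := hexp F hFr
    have h2 : ((boundary S F).card : ℝ) ≤ ℓ * B.card := by
      have h := Finset.card_le_card (boundary_subset_biUnion_of_adj_closed hcl G hG hFB)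
      have h' : (B.biUnion S).card ≤ B.card * ℓ :=
        Finset.card_biUnion_le_card_mul B S ℓ fun v _ => hℓ v
      have : ((boundary S F).card : ℝ) ≤ (B.card * ℓ : ℕ) := by exact_mod_cast h.trans h'
      push_cast at this
      linarith
    have h3 : (ℓ : ℝ) * B.card ≤ ℓ * (k + 1 : ℕ) :=
      mul_le_mul_of_nonneg_left (by exact_mod_cast hB) hℓ0
    have h4 : (r - 1) / 2 ≤ F.card := by
      have : (r₀ : ℝ) ≤ 2 * F.card := by exact_mod_cast hlo
      linarith
    calc c * (r - 1) / 2 = c * ((r - 1) / 2) := by ring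
      _ ≤ c * F.card := mul_le_mul_of_nonneg_left h4 hc.le
      _ ≤ (boundary S F).card := h1
      _ ≤ ℓ * B.card := h2
      _ ≤ ℓ * (k + 1 : ℕ) := h3
  · push Not at hkr
    have h1 : (r - 1) / 2 ≤ (k + 1 : ℕ) := by
      have : (r₀ : ℝ) + 1 ≤ 2 * (k + 1 : ℕ) := by exact_mod_cast hkr
      linarith
    have h2 : 0 ≤ (r - 1) / 2 := by linarith
    calc c * (r - 1) / 2 = c * ((r - 1) / 2) := by ring
      _ ≤ ℓ * (k + 1 : ℕ) := mul_le_mul hcℓ h1 h2 hℓ0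

end Treewidth

end Literature.Computability.MetaComplexity
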